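import Summits.Ventures.HodgeRepro.Tier3LemmaR

/-!
# Kernel fact 2 of Lemma R («`W_F(B)` is a rank-one `F`-module») from the dimension count

Blind re-derivation cell `pub-hodge-repro`, seat `t3-p4` (Tier 3, T3.5 for T3.4).  Target tree path
`lean/Summits/Ventures/HodgeRepro/Tier3WeilRankOne.lean`; imports Mathlib and the cell's `Tier3LemmaR`.

`Tier3LemmaR.lean` takes `WeilRankOne 𝓛` — «`W_F(B)` is `act`-stable and every non-zero `w ∈ W_F(B)` generates it:
`∀ x ∈ W_F(B), ∃ a, x = act a w`» — as a named hypothesis.  LEMMA-R-RESIDUE.md v5 §4(d) proves it on paper in two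
sentences: `W_F(B)` is an `F`-vector space under `act`; `W_F(B) ⊗ ℂ ≅ ⊕_{σ ∈ Hom(F,ℂ)} ℂ_σ`, hence `dim_ℚ W_F(B) = [F : ℚ]`
and `dim_F W_F(B) = 1`; «a one-dimensional `F`-vector space is spanned by any non-zero vector».  This file puts the
sentences on the kernel: (1) `finrank_eq_one_of_finrank_eq` — an `F`-space of `F₀`-dimension `[F : F₀]` is
one-dimensional over `F` (the tower law `Module.finrank_mul_finrank`); (2) `exists_smul_eq_of_finrank_eq` — in it every
non-zero vector generates (`finrank_eq_one_iff_of_nonzero'`); (3) `finrank_eq_of_basis_baseChange` — the dimension count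
from an eigenbasis of `K ⊗[F₀] W` indexed by `Gal(K/F₀)` (`Module.finrank_baseChange`, `IsGalois.card_aut_eq_finrank`);
(4) `weilRankOne_of_module` — `WeilRankOne 𝓛` for any `𝓛 : LemmaRData` whose Weil line carries an `F`-module structure
realised by `act` and has `ℚ`-dimension `[F : ℚ]`.

HONESTY.  Linear algebra on Mathlib composed with the route interface's named statement; the `F`-module structure of
`W_F(B)` through `act` and the eigen-decomposition of `W_F(B) ⊗ ℂ` are the note's PRINTED inputs (Deligne LNM 900 §4,
Milne 2020 §1.1) and stay on paper.  HC_CM is NOT proved by anyone in this repository.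
-/

set_option autoImplicit false

open TensorProduct

namespace HodgeRepro.Tier3

section General

variable {F₀ F W : Type*} [Field F₀] [Field F] [Algebra F₀ F] [FiniteDimensional F₀ F]
  [AddCommGroup W] [Module F W] [Module F₀ W] [IsScalarTower F₀ F W]

/-- An `F`-vector space whose `F₀`-dimension equals `[F : F₀]` is one-dimensional over `F` (tower law). -/
theorem finrank_eq_one_of_finrank_eq (h : Module.finrank F₀ W = Module.finrank F₀ F) :
    Module.finrank F W = 1 := by
  have h1 := Module.finrank_mul_finrank F₀ F W
  rw [h] at h1
  have hpos : 0 < Module.finrank F₀ F := Module.finrank_pos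
  exact Nat.eq_of_mul_eq_mul_left hpos (by rw [h1, mul_one])

/-- In an `F`-space of `F₀`-dimension `[F : F₀]`, every non-zero vector generates: `∀ x, ∃ a, x = a • w`. -/
theorem exists_smul_eq_of_finrank_eq (h : Module.finrank F₀ W = Module.finrank F₀ F) {w : W} (hw : w ≠ 0)
    (x : W) : ∃ a : F, x = a • w := by
  obtain ⟨a, ha⟩ := (finrank_eq_one_iff_of_nonzero' w hw).mp (finrank_eq_one_of_finrank_eq h) x
  exact ⟨a, ha.symm⟩

omit [Field F] [Algebra F₀ F] [FiniteDimensional F₀ F] [Module F W] [IsScalarTower F₀ F W] in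
/-- The dimension count: if `K ⊗[F₀] W` has a `K`-basis indexed by `Gal(K/F₀)` (one eigenline per embedding), then
`dim_{F₀} W = [K : F₀]`. -/
theorem finrank_eq_of_basis_baseChange {K : Type*} [Field K] [Algebra F₀ K] [FiniteDimensional F₀ K]
    [IsGalois F₀ K] (e : Module.Basis (K ≃ₐ[F₀] K) K (K ⊗[F₀] W)) :
    Module.finrank F₀ W = Module.finrank F₀ K := by
  rw [← Module.finrank_baseChange (R := K) (S := F₀) (M' := W), Module.finrank_eq_card_basis e,
    Fintype.card_eq_nat_card, IsGalois.card_aut_eq_finrank]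

end General

section Route

open HodgeRepro.Route

variable (𝓛 : LemmaRData)

/-- **Kernel fact 2 from the dimension count.**  If the Weil line `W_F(B)` of `𝓛 : LemmaRData` carries an `F`-vector
space structure (`F` a field, finite over `ℚ`) realised by `act` — `↑(a • w) = act a w` — and `dim_ℚ W_F(B) = [F : ℚ]`,
then `WeilRankOne 𝓛` holds: `W_F(B)` is `act`-stable and every non-zero `w ∈ W_F(B)` generates it. -/
theorem weilRankOne_of_module [Field 𝓛.F] [Algebra ℚ 𝓛.F] [FiniteDimensional ℚ 𝓛.F]
    [Module 𝓛.F (𝓛.𝓗.weil 𝓛.p 𝓛.B)] [IsScalarTower ℚ 𝓛.F (𝓛.𝓗.weil 𝓛.p 𝓛.B)]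
    (hact : ∀ (a : 𝓛.F) (w : 𝓛.𝓗.weil 𝓛.p 𝓛.B),
      ((a • w : 𝓛.𝓗.weil 𝓛.p 𝓛.B) : 𝓛.𝓗.H 𝓛.p 𝓛.B) = 𝓛.act a w)
    (hdim : Module.finrank ℚ (𝓛.𝓗.weil 𝓛.p 𝓛.B) = Module.finrank ℚ 𝓛.F) : WeilRankOne 𝓛 := by
  refine ⟨fun a w hw => ?_, fun w hw hw0 x hx => ?_⟩
  · rw [← hact a ⟨w, hw⟩]
    exact Submodule.coe_mem _
  · have hne : (⟨w, hw⟩ : 𝓛.𝓗.weil 𝓛.p 𝓛.B) ≠ 0 := fun h => hw0 (congrArg Subtype.val h)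
    obtain ⟨a, ha⟩ := exists_smul_eq_of_finrank_eq hdim hne ⟨x, hx⟩
    refine ⟨a, ?_⟩
    have h1 := congrArg Subtype.val ha
    rw [hact] at h1
    exact h1

end Route

end HodgeRepro.Tier3
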